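import Mathlib
import HarnessLib

/-!
# LINE (A) `product_plus_one` (crux `MatrixDescartes`, stmt-ValiantsHypothesis-18050, V1) — W-CB, brick E4a of the ORDER-6 ADDITIVE CERTIFICATE:
# the LOG-CURVATURE MARGIN SHELL («(log A)″ < (log G)″ ⇒ A − G has no three zeros») and the REPLICATOR BOUND for sums

Abstract engines (Mathlib only) for the in-ring lemma of memo `pub/val-lit/lmr/NOTE-p7g18-18050-LINEA-sixth-order-certificate.md` §6, in the θ-calculus of
✓ `…ThetaShell` / ✓ `…FarKneesMerge` (val-lit-p8 g17's `no_three_zeros_of_logConcave_sub_logConvex` is the margin-zero case `A·A₂ < A₁²`, `G₁² ≤ G·G₂`):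

* ★ `no_three_zeros_of_logCurvature_margin` — `A, G > 0` on a window `(u,v)` (`0 ≤ u`) with θ-towers `θA = A₁, θA₁ = A₂`, `θG = G₁, θG₁ = G₂`; if
  `(A·A₂ − A₁²)·G² < (G·G₂ − G₁²)·A²` pointwise (i.e. `θ²log A < θ²log G`: the lobe is MORE log-concave than the background, with any signs), then `A = G` at no
  three points of the window (`log A − log G` is strictly θ-concave: Rolle twice).
* ★ `replicator_curvature_bound` — for finitely many positive `bⱼ` with `bⱼ·b″ⱼ − b′ⱼ² ≥ −κ·bⱼ²` each, the sum obeys `(Σb)(Σb″) − (Σb′)² ≥ −κ·(Σb)²`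
  (`θ²log Σbⱼ ≥ minⱼ θ²log bⱼ`; Cauchy–Schwarz `(Σb′)² ≤ (Σb)(Σ b′²/b)`) — so a background assembled from pieces with log-curvature `≥ −κ` has log-curvature `≥ −κ`.

USE (memo §6, (RING-ISO)): on a ring interval of an isolated fast knee, `A = w·ℓ` (the knee's `L₃`-lobe, `θ²log ℓ ≤ −2.07ρ²`, located) and `G = Σ` of the other rows'
`L₃`-images (`θ²log ≥ −0.6ρ²` piecewise, located) ⇒ `L₃Φ = G − A` has ≤ 2 zeros there.  The per-row curvature bounds are one-variable polynomial inequalities in the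
tower (NOT in this file).

HONEST FRAMING: abstract calculus/algebra; proves nothing about `WronskianBudgetK3` / `OneChangeFloorK3` / the stubs / 18050 / `MatrixDescartes` / B by itself;
`VP ≠ VNP` is NOT proved.  No definitions, no named facts, no sorry; Mathlib + HarnessLib only.
-/

set_option linter.dupNamespace false

namespace Summit.ValiantsHypothesis.ValiantsHypothesis.Theorems.LacunarySymmetroidMatrixDescartes

namespace ProductPlusOne

open Set Finset
open scoped BigOperators

/-! ### §1 The log-curvature margin shell -/

/-- ★ **LOG-CURVATURE MARGIN SHELL.**  `A, G > 0` on `(u,v)` (`0 ≤ u`) with θ-towers; if `(A·A₂ − A₁²)·G² < (G·G₂ − G₁²)·A²` on the window, then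
`A = G` at no three points `x₁ < x₂ < x₃` of the window. [this file's theorem] -/
theorem no_three_zeros_of_logCurvature_margin {A A₁ A₂ G G₁ G₂ : ℝ → ℝ} {u v : ℝ} (hu : 0 ≤ u)
    (hA : ∀ x ∈ Ioo u v, HasDerivAt A (A₁ x / x) x) (hA₁ : ∀ x ∈ Ioo u v, HasDerivAt A₁ (A₂ x / x) x)
    (hG : ∀ x ∈ Ioo u v, HasDerivAt G (G₁ x / x) x) (hG₁ : ∀ x ∈ Ioo u v, HasDerivAt G₁ (G₂ x / x) x)
    (hApos : ∀ x ∈ Ioo u v, 0 < A x) (hGpos : ∀ x ∈ Ioo u v, 0 < G x)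
    (hmargin : ∀ x ∈ Ioo u v, (A x * A₂ x - A₁ x ^ 2) * G x ^ 2 < (G x * G₂ x - G₁ x ^ 2) * A x ^ 2)
    {x₁ x₂ x₃ : ℝ} (h₁ : x₁ ∈ Ioo u v) (h₃ : x₃ ∈ Ioo u v) (h12 : x₁ < x₂) (h23 : x₂ < x₃)
    (hz₁ : A x₁ = G x₁) (hz₂ : A x₂ = G x₂) (hz₃ : A x₃ = G x₃) : False := by
  have h₂ : x₂ ∈ Ioo u v := ⟨h₁.1.trans h12, h23.trans h₃.2⟩
  have hpos : ∀ x ∈ Ioo u v, 0 < x := fun x hx => hu.trans_lt hx.1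
  have hIc : (Ioo u v).OrdConnected := ordConnected_Ioo
  set h : ℝ → ℝ := fun x => Real.log (A x) - Real.log (G x) with hhdef
  set hθ : ℝ → ℝ := fun x => A₁ x / A x - G₁ x / G x with hhθdef
  have hh : ∀ x ∈ Ioo u v, HasDerivAt h (hθ x / x) x := by
    intro x hx
    have hx0 : x ≠ 0 := (hpos x hx).ne'
    have hA0 := (hApos x hx).ne'
    have hG0 := (hGpos x hx).ne'
    have := ((hA x hx).log hA0).sub ((hG x hx).log hG0)
    refine this.congr_deriv ?_
    simp only [hhθdef]
    field_simp
  set hθ' : ℝ → ℝ := fun x => ((A x * A₂ x - A₁ x ^ 2) / A x ^ 2 - (G x * G₂ x - G₁ x ^ 2) / G x ^ 2) / x with hhθ'def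
  have hhθ : ∀ x ∈ Ioo u v, HasDerivAt hθ (hθ' x) x := by
    intro x hx
    have hx0 : x ≠ 0 := (hpos x hx).ne'
    have hA0 := (hApos x hx).ne'
    have hG0 := (hGpos x hx).ne'
    have := ((hA₁ x hx).div (hA x hx) hA0).sub ((hG₁ x hx).div (hG x hx) hG0)
    refine this.congr_deriv ?_
    simp only [hhθ'def]
    field_simp
  have hθ'_neg : ∀ x ∈ Ioo u v, hθ' x < 0 := by
    intro x hx
    have hxp := hpos x hx
    have hA' := hApos x hx
    have hG' := hGpos x hx
    have hA2 : 0 < A x ^ 2 := by positivity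
    have hG2 : 0 < G x ^ 2 := by positivity
    have hlt : (A x * A₂ x - A₁ x ^ 2) / A x ^ 2 < (G x * G₂ x - G₁ x ^ 2) / G x ^ 2 := by
      rw [div_lt_div_iff₀ hA2 hG2]
      exact hmargin x hx
    simp only [hhθ'def]
    exact div_neg_of_neg_of_pos (by linarith) hxp
  have hz : ∀ x ∈ Ioo u v, A x = G x → h x = 0 := by
    intro x hx hAG
    simp only [hhdef, hAG, sub_self]
  have rolle1 : ∀ {p q : ℝ}, p ∈ Ioo u v → q ∈ Ioo u v → p < q → h p = 0 → h q = 0 → ∃ c ∈ Ioo p q, hθ c = 0 := by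
    intro p q hp hq hpq hhp hhq
    have hsub : Icc p q ⊆ Ioo u v := hIc.out hp hq
    have hcont : ContinuousOn h (Icc p q) := fun t ht => (hh t (hsub ht)).continuousAt.continuousWithinAt
    obtain ⟨c, hc, hc'⟩ := exists_hasDerivAt_eq_zero hpq hcont (by rw [hhp, hhq])
      (fun t ht => hh t (hsub (Ioo_subset_Icc_self ht)))
    have hcI := hsub (Ioo_subset_Icc_self hc)
    exact ⟨c, hc, (div_eq_zero_iff.1 hc').resolve_right (hpos c hcI).ne'⟩
  obtain ⟨c₁, hc₁, hc₁'⟩ := rolle1 h₁ h₂ h12 (hz _ h₁ hz₁) (hz _ h₂ hz₂)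
  obtain ⟨c₂, hc₂, hc₂'⟩ := rolle1 h₂ h₃ h23 (hz _ h₂ hz₂) (hz _ h₃ hz₃)
  have hc₁I : c₁ ∈ Ioo u v := ⟨h₁.1.trans hc₁.1, hc₁.2.trans h₂.2⟩
  have hc₂I : c₂ ∈ Ioo u v := ⟨h₂.1.trans hc₂.1, hc₂.2.trans h₃.2⟩
  have hc12 : c₁ < c₂ := hc₁.2.trans hc₂.1
  have hsub : Icc c₁ c₂ ⊆ Ioo u v := hIc.out hc₁I hc₂I
  have hcont : ContinuousOn hθ (Icc c₁ c₂) := fun t ht => (hhθ t (hsub ht)).continuousAt.continuousWithinAt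
  obtain ⟨c, hc, hc'⟩ := exists_hasDerivAt_eq_zero hc12 hcont (by rw [hc₁', hc₂'])
    (fun t ht => hhθ t (hsub (Ioo_subset_Icc_self ht)))
  have hcI := hsub (Ioo_subset_Icc_self hc)
  exact absurd hc' (hθ'_neg c hcI).ne

/-- **Weighted form**: the same with `A = w·L`, `w > 0` (a knee of multiplicity `w`): the margin hypothesis is weight-free. [this file's theorem] -/
theorem no_three_zeros_of_logCurvature_margin_smul {L L₁ L₂ G G₁ G₂ : ℝ → ℝ} {u v w : ℝ} (hu : 0 ≤ u) (hw : 0 < w)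
    (hL : ∀ x ∈ Ioo u v, HasDerivAt L (L₁ x / x) x) (hL₁ : ∀ x ∈ Ioo u v, HasDerivAt L₁ (L₂ x / x) x)
    (hG : ∀ x ∈ Ioo u v, HasDerivAt G (G₁ x / x) x) (hG₁ : ∀ x ∈ Ioo u v, HasDerivAt G₁ (G₂ x / x) x)
    (hLpos : ∀ x ∈ Ioo u v, 0 < L x) (hGpos : ∀ x ∈ Ioo u v, 0 < G x)
    (hmargin : ∀ x ∈ Ioo u v, (L x * L₂ x - L₁ x ^ 2) * G x ^ 2 < (G x * G₂ x - G₁ x ^ 2) * L x ^ 2)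
    {x₁ x₂ x₃ : ℝ} (h₁ : x₁ ∈ Ioo u v) (h₃ : x₃ ∈ Ioo u v) (h12 : x₁ < x₂) (h23 : x₂ < x₃)
    (hz₁ : w * L x₁ = G x₁) (hz₂ : w * L x₂ = G x₂) (hz₃ : w * L x₃ = G x₃) : False := by
  refine no_three_zeros_of_logCurvature_margin (A := fun x => w * L x) (A₁ := fun x => w * L₁ x) (A₂ := fun x => w * L₂ x) hu
    (fun x hx => by simpa [mul_div_assoc] using (hL x hx).const_mul w)
    (fun x hx => by simpa [mul_div_assoc] using (hL₁ x hx).const_mul w) hG hG₁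
    (fun x hx => mul_pos hw (hLpos x hx)) hGpos (fun x hx => ?_) h₁ h₃ h12 h23 hz₁ hz₂ hz₃
  have h := hmargin x hx
  have hw2 : 0 < w ^ 2 := by positivity
  have : (w * L x * (w * L₂ x) - (w * L₁ x) ^ 2) * G x ^ 2 = w ^ 2 * ((L x * L₂ x - L₁ x ^ 2) * G x ^ 2) := by ring
  have : (G x * G₂ x - G₁ x ^ 2) * (w * L x) ^ 2 = w ^ 2 * ((G x * G₂ x - G₁ x ^ 2) * L x ^ 2) := by ring
  nlinarith [mul_lt_mul_of_pos_left h hw2]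

/-! ### §2 The replicator bound for sums -/

/-- **Cauchy–Schwarz in Sedrakyan form**: for positive weights `bⱼ`, `(Σ b′ⱼ)² ≤ (Σ bⱼ)·(Σ b′ⱼ²/bⱼ)`. [folklore] -/
theorem sq_sum_le_sum_mul_sum_sq_div {ι : Type*} (s : Finset ι) (b b' : ι → ℝ) (hb : ∀ j ∈ s, 0 < b j) :
    (∑ j ∈ s, b' j) ^ 2 ≤ (∑ j ∈ s, b j) * ∑ j ∈ s, b' j ^ 2 / b j := by
  have h := Finset.sum_mul_sq_le_sq_mul_sq s (fun j => Real.sqrt (b j)) (fun j => b' j / Real.sqrt (b j))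
  have h1 : ∀ j ∈ s, Real.sqrt (b j) * (b' j / Real.sqrt (b j)) = b' j := by
    intro j hj
    have hs : Real.sqrt (b j) ≠ 0 := (Real.sqrt_pos.2 (hb j hj)).ne'
    field_simp
  have h2 : ∀ j ∈ s, Real.sqrt (b j) ^ 2 = b j := fun j hj => Real.sq_sqrt (hb j hj).le
  have h3 : ∀ j ∈ s, (b' j / Real.sqrt (b j)) ^ 2 = b' j ^ 2 / b j := by
    intro j hj
    rw [div_pow, Real.sq_sqrt (hb j hj).le]
  rw [Finset.sum_congr rfl h1, Finset.sum_congr rfl h2, Finset.sum_congr rfl h3] at h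
  exact h

/-- ★ **REPLICATOR CURVATURE BOUND.**  Positive pieces `bⱼ` with `bⱼ·b″ⱼ − b′ⱼ² ≥ −κ·bⱼ²` (each piece has θ²log ≥ −κ) sum to a function with
`(Σb)(Σb″) − (Σb′)² ≥ −κ(Σb)²`. [this file's theorem] -/
theorem replicator_curvature_bound {ι : Type*} (s : Finset ι) (b b' b'' : ι → ℝ) (κ : ℝ) (hb : ∀ j ∈ s, 0 < b j)
    (hcurv : ∀ j ∈ s, -κ * b j ^ 2 ≤ b j * b'' j - b' j ^ 2) :
    -κ * (∑ j ∈ s, b j) ^ 2 ≤ (∑ j ∈ s, b j) * (∑ j ∈ s, b'' j) - (∑ j ∈ s, b' j) ^ 2 := by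
  have hS : 0 ≤ ∑ j ∈ s, b j := Finset.sum_nonneg fun j hj => (hb j hj).le
  -- termwise: b″ⱼ ≥ b′ⱼ²/bⱼ − κ bⱼ
  have hterm : ∀ j ∈ s, b' j ^ 2 / b j - κ * b j ≤ b'' j := by
    intro j hj
    have hbj := hb j hj
    rw [div_sub' (hbj.ne'), div_le_iff₀ hbj]
    nlinarith [hcurv j hj]
  have hsum : ∑ j ∈ s, (b' j ^ 2 / b j - κ * b j) ≤ ∑ j ∈ s, b'' j := Finset.sum_le_sum hterm
  rw [Finset.sum_sub_distrib, ← Finset.mul_sum] at hsum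
  have hcs := sq_sum_le_sum_mul_sum_sq_div s b b' hb
  have hmul := mul_le_mul_of_nonneg_left hsum hS
  nlinarith [hmul, hcs]

end ProductPlusOne

end Summit.ValiantsHypothesis.ValiantsHypothesis.Theorems.LacunarySymmetroidMatrixDescartes
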